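import Mathlib
import Literature.Computability.Complexity.CliqueTestGraphs
import Literature.GroupTheory.PermutationGroups.SmallIndexSubgroups
import Summits.PneNP.PneNP.Theorems.ConvexRankGatesConvexGateBlindSymmetricBlind
import Summits.PneNP.PneNP.Theorems.ConvexRankGatesConvexGateBlindSharpJunta

/-!
# PneNP / ConvexRankGates — `ConvexGateBlind`: symmetric LP certificates are blind up to the sharp locality

Helpers (`--supports stmt-PneNP-10680`). `…SymmetricBlind.lean` with the sharp junta theorem of `…SharpJunta.lean`
(`#S_l ≤ K` instead of `2 #S_l ≤ K`) plugged in: for a balanced `K`-colouring column (`K ≥ 2` classes of size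
`n ≥ K + 1`), `8 < m`, `4(t+1) ≤ m` and `t + 1 ≤ K` (one spare vertex for the parity correction), every
`Sym(m)`-symmetric family of non-negative row objects with `#L < C(m, t+1)` fails the identity
`cdist Q (colorVec h) - ε = ∑_l c_l V_l(Q)` for every `ε > 0` (`cdist_colorVec_not_symmetricRep_sharp`, registered stub
`symmetric_blind_sharp`). So symmetric non-negative factorisations of the colouring columns of `D - εJ` need at least
`C(m, K) = C(m, k-1)` terms (was `C(m, ⌊K/2⌋+1)`), against the symmetric class-window upper bound `C(m, m/K)`. [new]
-/

set_option linter.dupNamespace false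

namespace Summit.PneNP.PneNP.Theorems

open Finset Literature.Computability.Complexity
open Summit.PneNP.PneNP.Cruxes.ConvexGateBlind.StrictRankConicCover (cdist)

noncomputable section

variable {m : ℕ}

/-! ## Alt-stabiliser-invariant certificates are blind -/

/-- **`Alt`-stabiliser-invariant non-negative certificates are ε-exactly blind on colouring columns.** As
`cdist_colorVec_not_stabInvariantRep`, but each `V_l` need only be invariant (on `(K+1)`-sets) under the EVEN vertex
permutations fixing `W_l` (`#W_l ≤ t`, `t + 1 ≤ K`) pointwise. [new] -/
theorem cdist_colorVec_not_altStabInvariantRep_sharp {K : ℕ} (h : Fin m → Fin K) {n t : ℕ}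
    (hn : ∀ c, (cls h c).card = n) (hK : 2 ≤ K) (hKn : K + 1 ≤ n) (ht : t + 1 ≤ K) {ε : ℝ} (hε : 0 < ε)
    {ι : Type*} [Fintype ι] (W : ι → Finset (Fin m)) (hW : ∀ l, (W l).card ≤ t) (V : ι → Finset (Fin m) → ℝ)
    (hV0 : ∀ l Q, Q.card = K + 1 → 0 ≤ V l Q)
    (hV : ∀ l (σ : Equiv.Perm (Fin m)), Equiv.Perm.sign σ = 1 → (∀ w ∈ W l, σ w = w) →
      ∀ Q : Finset (Fin m), Q.card = K + 1 → V l (Q.map σ.toEmbedding) = V l Q) :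
    ¬ ∀ Q : Finset (Fin m), Q.card = K + 1 → cdist Q (colorVec h) - ε = ∑ l, V l Q := by
  classical
  intro hrep
  let F : ι → Finset (Fin m) → ℝ := fun l P =>
    if hP : ∃ Q : Finset (Fin m), Q.card = K + 1 ∧ Q ∩ W l = P then V l hP.choose else 0
  have hF : ∀ l (Q : Finset (Fin m)), Q.card = K + 1 → V l Q = F l (Q ∩ W l) := by
    intro l Q hQ
    have hP : ∃ Q' : Finset (Fin m), Q'.card = K + 1 ∧ Q' ∩ W l = Q ∩ W l := ⟨Q, hQ, rfl⟩
    simp only [F, dif_pos hP]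
    have hcW : (W l).card + 2 ≤ K + 1 := by have := hW l; omega
    exact eq_of_altStabiliserInvariant (V l) (W l) hcW (hV l) _ Q hP.choose le_rfl hQ hP.choose_spec.1
      hP.choose_spec.2.symm
  refine cdist_colorVec_not_juntaRep_sharp h hn hK hKn (by omega) hε W F hW ?_ ?_
  · intro l P
    simp only [F]
    split_ifs with hP
    · exact hV0 l _ hP.choose_spec.1
    · exact le_refl _
  · intro Q hQ
    rw [hrep Q hQ]
    exact Finset.sum_congr rfl fun l _ => hF l Q hQ

/-! ## The theorem: symmetric certificates are blind -/

/-- **Symmetric non-negative certificates are ε-exactly blind on colouring columns (unconditional).** Let `h` be a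
balanced `K`-colouring of `Fin m` (`K ≥ 2` classes of size `n ≥ K + 1`), `t + 1 ≤ K`, `8 < m`, `4(t+1) ≤ m`; let
`(V_l)_{l ∈ L}` be a `Sym(m)`-symmetric family of functions on vertex sets (`V_{τ σ l}(σ Q) = V_l(Q)`) which are
non-negative on `(K+1)`-sets, with `#L < C(m, t+1)`. Then for every `ε > 0` and all `c_l ≥ 0` there is NO identity
`cdist Q (colorVec h) - ε = ∑_l c_l V_l(Q)` on the `(K+1)`-sets. (Stabilisers of terms have index `≤ #L`;
Dixon–Mortimer 5.2B makes every `V_l` invariant under the even permutations fixing `≤ t` points; then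
`cdist_colorVec_not_altStabInvariantRep`.) [new; Yannakakis 1991, Claim 2] -/
theorem cdist_colorVec_not_symmetricRep_sharp {K : ℕ} (h : Fin m → Fin K) {n t : ℕ} (hn : ∀ c, (cls h c).card = n)
    (hK : 2 ≤ K) (hKn : K + 1 ≤ n) (ht : t + 1 ≤ K) (hm8 : 8 < m) (h4t : 4 * (t + 1) ≤ m)
    {ε : ℝ} (hε : 0 < ε) {L : Type*} [Fintype L] (hL : Fintype.card L < m.choose (t + 1))
    (V : Finset (Fin m) → L → ℝ) (τ : Equiv.Perm (Fin m) → L → L)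
    (hτ : ∀ σ l Q, V (Q.map σ.toEmbedding) (τ σ l) = V Q l)
    (hV0 : ∀ l Q, Q.card = K + 1 → 0 ≤ V Q l) (c : L → ℝ) (hc : ∀ l, 0 ≤ c l) :
    ¬ ∀ Q : Finset (Fin m), Q.card = K + 1 → cdist Q (colorVec h) - ε = ∑ l, c l * V Q l := by
  classical
  intro hrep
  -- every term is invariant under the even permutations fixing a small set
  have hstab : ∀ l, ∃ X : Finset (Fin m), X.card ≤ t ∧ ∀ ρ : Equiv.Perm (Fin m), Equiv.Perm.sign ρ = 1 →
      (∀ x ∈ X, ρ x = x) → ∀ Q : Finset (Fin m), V (Q.map ρ.toEmbedding) l = V Q l := by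
    intro l
    obtain ⟨H, hH, hidx⟩ := XorDoor.exists_stabilizer_index_le (G := Equiv.Perm (Fin m))
      (A := Finset (Fin m)) (fun σ Q => Q.map σ.toEmbedding)
      (fun Q => by
        show Q.map (1 : Equiv.Perm (Fin m)).toEmbedding = Q
        rw [Equiv.Perm.one_def, Equiv.refl_toEmbedding, Finset.map_refl])
      (fun g g' Q => by
        show Q.map (g * g').toEmbedding = (Q.map g'.toEmbedding).map g.toEmbedding
        rw [Equiv.Perm.mul_def, Equiv.trans_toEmbedding, Finset.map_map])
      V τ hτ l
    have hidx' : H.index < (Fintype.card (Fin m)).choose (t + 1) := by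
      rw [Fintype.card_fin]; exact lt_of_le_of_lt hidx hL
    obtain ⟨X, hXcard, hX⟩ :=
      Literature.GroupTheory.PermutationGroups.alternating_fixing_le_of_index_lt_choose H (t + 1)
        (by rw [Fintype.card_fin]; exact hm8) (Nat.succ_pos t) (by rw [Fintype.card_fin]; exact h4t) hidx'
    exact ⟨X, by omega, fun ρ hsign hfix Q => (hH ρ).1 (hX ρ hfix hsign) Q⟩
  choose X hXt hXinv using hstab
  refine cdist_colorVec_not_altStabInvariantRep_sharp h hn hK hKn ht hε X hXt (fun l Q => c l * V Q l) ?_ ?_ ?_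
  · intro l Q hQ
    exact mul_nonneg (hc l) (hV0 l Q hQ)
  · intro l σ hsign hfix Q _
    show c l * V (Q.map σ.toEmbedding) l = c l * V Q l
    rw [hXinv l σ hsign hfix Q]
  · intro Q hQ
    rw [hrep Q hQ]

/-- **Registered helper stub (symmetric certificates are blind up to the sharp locality).** Restatement of
`cdist_colorVec_not_symmetricRep_sharp` with all parameters explicit. -/
theorem symmetric_blind_sharp : ∀ {m K n t : ℕ} (h : Fin m → Fin K), (∀ c, (cls h c).card = n) → 2 ≤ K → K + 1 ≤ n → t + 1 ≤ K → 8 < m → 4 * (t + 1) ≤ m → ∀ (ε : ℝ), 0 < ε → ∀ {L : Type} [Fintype L], Fintype.card L < m.choose (t + 1) → ∀ (V : Finset (Fin m) → L → ℝ) (τ : Equiv.Perm (Fin m) → L → L), (∀ σ l Q, V (Q.map σ.toEmbedding) (τ σ l) = V Q l) → (∀ l Q, Q.card = K + 1 → 0 ≤ V Q l) → ∀ (c : L → ℝ), (∀ l, 0 ≤ c l) → ¬ ∀ Q : Finset (Fin m), Q.card = K + 1 → cdist Q (colorVec h) - ε = ∑ l, c l * V Q l := by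
  intro m K n t h hn hK hKn ht hm8 h4t ε hε L _ hL V τ hτ hV0 c hc
  exact cdist_colorVec_not_symmetricRep_sharp h hn hK hKn ht hm8 h4t hε hL V τ hτ hV0 c hc

end

end Summit.PneNP.PneNP.Theorems
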